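import Mathlib.Algebra.BigOperators.Finsupp.Basic
import Mathlib.Algebra.Order.BigOperators.Group.Finset
import Mathlib.Data.Int.Order.Basic
import Literature.Computability.Complexity.CNF
import HarnessLib

/-!
# The cutting planes proof system `CP`

Cutting planes as a refutation system for CNFs (Cook–Coullard–Turán 1987, §2; Krajíček 2019,
§6.3; Pudlák 1997, §3): lines are integer linear inequalities `∑_v a_v x_v ≥ b` in Boolean
variables (`CPLine`, coefficients as a finitely supported function `ν →₀ ℤ`), axioms are the
inequalities of the clauses of the refuted CNF (`CPLine.ofClause`: the clause `⋁ lᵢ` becomes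
`∑ lᵢ ≥ 1` with `¬x` read as `1 - x`) and the bounds `x ≥ 0`, `-x ≥ -1` (`CPLine.lower`,
`CPLine.upper`), and the rules are ADDITION of two lines, MULTIPLICATION by a natural number and
the Gomory–Chvátal DIVISION rule: from `∑ (c·a_v) x_v ≥ b` infer `∑ a_v x_v ≥ ⌈b / c⌉`
(`CPLine.divBy`, `CPLine.ceilDiv`).  A refutation is a derivation (`IsCPDerivation`, lines
annotated by their rule as in `Resolution.lean`) containing a contradiction `0 ≥ b`, `b > 0`
(`IsCPRefutation`).

Proved here: the semantics of the axioms (`CPLine.holds_ofClause_iff`), soundness of the rules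
and of the system (`CPLine.Holds.add/.smul/.divBy`, `holds_of_isCPDerivation`,
`not_satisfiable_of_isCPRefutation`), and the bookkeeping of the `ℓ¹`-NORM of lines and proofs
(`CPLine.norm`, `cpNorm`) used by the interpolation theorem for proofs with small coefficients
(`CuttingPlanesInterpolation.lean`).

## References

* W. Cook, C. R. Coullard, Gy. Turán, *On the complexity of cutting-plane proofs*, Discrete
  Appl. Math. 18 (1987) 25–38, §2 [CookCoullardTuran1987].
* J. Krajíček, *Proof complexity* (CUP 2019), §6.3 [KrajicekProofComplexity2019].
* P. Pudlák, J. Symbolic Logic 62 (1997), §3 [Pudlak1997].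

Not here: completeness and the p-simulation of resolution (Cook–Coullard–Turán 1987, Prop. 2);
size measures beyond the number of lines and the norm.
-/

namespace Literature.Computability.MetaComplexity

open Finset Literature.Computability.Complexity

/-- A line of a cutting planes proof: the integer linear inequality `∑_v coeff v · x_v ≥ const`
in Boolean variables `x_v`. [cite: CookCoullardTuran1987, §2] -/
structure CPLine (ν : Type*) where
  /-- the coefficients `a_v` (finitely many nonzero) -/
  coeff : ν →₀ ℤ
  /-- the right-hand side `b` -/
  const : ℤ

namespace CPLine

variable {ν : Type*}

/-! ### Semantics -/

/-- The `0/1` value of a Boolean variable. [folklore] -/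
def bit (σ : ν → Bool) (v : ν) : ℤ := if σ v then 1 else 0

/-- `bit` is `0` or `1`. [folklore] -/
theorem bit_nonneg (σ : ν → Bool) (v : ν) : 0 ≤ bit σ v := by
  unfold bit; split_ifs <;> norm_num

/-- `bit` is `0` or `1`. [folklore] -/
theorem bit_le_one (σ : ν → Bool) (v : ν) : bit σ v ≤ 1 := by
  unfold bit; split_ifs <;> norm_num

/-- Evaluation of a coefficient vector at a Boolean assignment, `∑_v a_v σ(v)`, as an additive
homomorphism in the coefficient vector. [cite: CookCoullardTuran1987, §2] -/
noncomputable def evalHom (σ : ν → Bool) : (ν →₀ ℤ) →+ ℤ :=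
  Finsupp.liftAddHom fun v => AddMonoidHom.mulRight (bit σ v)

/-- `evalHom` on a single coefficient. [folklore] -/
@[simp] theorem evalHom_single (σ : ν → Bool) (v : ν) (a : ℤ) :
    evalHom σ (Finsupp.single v a) = a * bit σ v := by
  simp [evalHom]

/-- The left-hand side `∑_v a_v σ(v)` of a line under an assignment.
[cite: CookCoullardTuran1987, §2] -/
noncomputable def lhs (L : CPLine ν) (σ : ν → Bool) : ℤ := evalHom σ L.coeff

/-- A line HOLDS under `σ` if `const ≤ ∑_v a_v σ(v)`. [cite: CookCoullardTuran1987, §2] -/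
def Holds (L : CPLine ν) (σ : ν → Bool) : Prop := L.const ≤ L.lhs σ

/-- `evalHom` as a sum over the support. [folklore] -/
theorem evalHom_eq_sum (σ : ν → Bool) (f : ν →₀ ℤ) :
    evalHom σ f = f.sum fun v a => a * bit σ v := by
  simp [evalHom, Finsupp.liftAddHom_apply]

/-- `|∑ a_v σ(v)| ≤ ∑ |a_v|`. [folklore] -/
theorem abs_evalHom_le (σ : ν → Bool) (f : ν →₀ ℤ) :
    |evalHom σ f| ≤ f.sum fun _ a => |a| := by
  rw [evalHom_eq_sum]
  refine (Finset.abs_sum_le_sum_abs _ _).trans (Finset.sum_le_sum fun v _ => ?_)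
  rw [abs_mul]
  calc |f v| * |bit σ v| ≤ |f v| * 1 :=
        mul_le_mul_of_nonneg_left (by rw [abs_le]; exact ⟨by linarith [bit_nonneg σ v], bit_le_one σ v⟩)
          (abs_nonneg _)
    _ = |f v| := mul_one _

/-! ### The lines of the system -/

/-- Addition of lines (coefficientwise, and of the constants). [cite: CookCoullardTuran1987, §2] -/
noncomputable instance : Add (CPLine ν) := ⟨fun L M => ⟨L.coeff + M.coeff, L.const + M.const⟩⟩

/-- Coefficients of a sum. [folklore] -/
@[simp] theorem coeff_add (L M : CPLine ν) : (L + M).coeff = L.coeff + M.coeff := rfl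

/-- Constant of a sum. [folklore] -/
@[simp] theorem const_add (L M : CPLine ν) : (L + M).const = L.const + M.const := rfl

/-- Multiplication of a line by a natural number. [cite: CookCoullardTuran1987, §2] -/
noncomputable def smul (c : ℕ) (L : CPLine ν) : CPLine ν := ⟨(c : ℤ) • L.coeff, c * L.const⟩

/-- Rounding-up integer division `⌈d / c⌉` (for `c > 0`). [cite: CookCoullardTuran1987, §2] -/
def ceilDiv (d : ℤ) (c : ℕ) : ℤ := -((-d) / (c : ℤ))

/-- The Gomory–Chvátal DIVISION of a line by `c`: divide the coefficients (assumed divisible)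
and round the constant UP. [cite: CookCoullardTuran1987, §2] -/
noncomputable def divBy (c : ℕ) (L : CPLine ν) : CPLine ν :=
  ⟨L.coeff.mapRange (· / (c : ℤ)) (by simp), ceilDiv L.const c⟩

/-- The bound axiom `x_v ≥ 0`. [cite: CookCoullardTuran1987, §2] -/
noncomputable def lower (v : ν) : CPLine ν := ⟨Finsupp.single v 1, 0⟩

/-- The bound axiom `-x_v ≥ -1`, i.e. `x_v ≤ 1`. [cite: CookCoullardTuran1987, §2] -/
noncomputable def upper (v : ν) : CPLine ν := ⟨Finsupp.single v (-1), -1⟩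

/-- The coefficient vector of a literal: `x` for a positive, `-x` for a negative literal (the
latter standing for `1 - x`, the `1` being moved to the right-hand side). [cite: CookCoullardTuran1987, §2] -/
noncomputable def litCoeff (l : Literal ν) : ν →₀ ℤ := Finsupp.single l.1 (if l.2 then 1 else -1)

/-- The inequality of a clause `⋁ lᵢ`: `∑_{positive} x - ∑_{negative} x ≥ 1 - #negative`
(literals of the clause counted once). [cite: CookCoullardTuran1987, §2] -/
noncomputable def ofClause [DecidableEq ν] (C : Clause ν) : CPLine ν :=
  ⟨∑ l ∈ C.toFinset, litCoeff l, 1 - ((C.toFinset.filter fun l => l.2 = false).card : ℤ)⟩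

/-- A CONTRADICTION: the line `0 ≥ b` with `b > 0`. [cite: CookCoullardTuran1987, §2] -/
def IsContradiction (L : CPLine ν) : Prop := L.coeff = 0 ∧ 0 < L.const

/-! ### Soundness of axioms and rules -/

/-- `lhs` of a sum. [folklore] -/
@[simp] theorem lhs_add (L M : CPLine ν) (σ : ν → Bool) : (L + M).lhs σ = L.lhs σ + M.lhs σ := by
  simp [lhs]

/-- `lhs` of a multiple. [folklore] -/
@[simp] theorem lhs_smul (c : ℕ) (L : CPLine ν) (σ : ν → Bool) : (smul c L).lhs σ = c * L.lhs σ := by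
  simp [lhs, smul]

/-- Constant of a multiple. [folklore] -/
@[simp] theorem const_smul (c : ℕ) (L : CPLine ν) : (smul c L).const = c * L.const := rfl

/-- Constant of a division. [folklore] -/
@[simp] theorem const_divBy (c : ℕ) (L : CPLine ν) : (divBy c L).const = ceilDiv L.const c := rfl

/-- Coefficients of a division. [folklore] -/
@[simp] theorem coeff_divBy_apply (c : ℕ) (L : CPLine ν) (v : ν) :
    (divBy c L).coeff v = L.coeff v / (c : ℤ) := by
  simp [divBy]

/-- If `c` divides every coefficient, `c · (divided coefficients) = coefficients`. [folklore] -/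
theorem smul_coeff_divBy {c : ℕ} {L : CPLine ν} (h : ∀ v, (c : ℤ) ∣ L.coeff v) :
    (c : ℤ) • (divBy c L).coeff = L.coeff := by
  ext v
  simp only [Finsupp.coe_smul, Pi.smul_apply, smul_eq_mul, coeff_divBy_apply]
  exact Int.mul_ediv_cancel' (h v)

/-- If `c` divides every coefficient, `c · lhs (L / c) = lhs L`. [folklore] -/
theorem mul_lhs_divBy {c : ℕ} {L : CPLine ν} (h : ∀ v, (c : ℤ) ∣ L.coeff v) (σ : ν → Bool) :
    (c : ℤ) * (divBy c L).lhs σ = L.lhs σ := by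
  have := congrArg (evalHom σ) (smul_coeff_divBy h)
  rw [map_zsmul, smul_eq_mul] at this
  exact this

/-- `e ≥ ⌈d/c⌉` as soon as `c e ≥ d` (`c > 0`). [folklore] -/
theorem ceilDiv_le_of_le_mul {d e : ℤ} {c : ℕ} (hc : 0 < c) (h : d ≤ (c : ℤ) * e) : ceilDiv d c ≤ e := by
  unfold ceilDiv
  rw [neg_le, Int.le_ediv_iff_mul_le (by exact_mod_cast hc)]
  linarith

/-- `⌈d/c⌉` is the least such `e`: `c ⌈d/c⌉ ≥ d`. [folklore] -/
theorem le_mul_ceilDiv (d : ℤ) {c : ℕ} (hc : 0 < c) : d ≤ (c : ℤ) * ceilDiv d c := by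
  unfold ceilDiv
  have hc' : (0 : ℤ) < c := by exact_mod_cast hc
  have h1 : (-d) / (c : ℤ) * (c : ℤ) ≤ -d := Int.ediv_mul_le _ hc'.ne'
  linarith [mul_comm ((-d) / (c : ℤ)) (c : ℤ)]

/-- `⌈·/c⌉` is monotone. [folklore] -/
theorem ceilDiv_mono {d d' : ℤ} (h : d ≤ d') (c : ℕ) : ceilDiv d c ≤ ceilDiv d' c := by
  unfold ceilDiv
  rcases Nat.eq_zero_or_pos c with rfl | hc
  · simp
  · exact neg_le_neg (Int.ediv_le_ediv (by exact_mod_cast hc) (neg_le_neg h))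

/-- `⌈·/c⌉` is subadditive (`c > 0`). [folklore] -/
theorem ceilDiv_add_le {d d' : ℤ} {c : ℕ} (hc : 0 < c) :
    ceilDiv (d + d') c ≤ ceilDiv d c + ceilDiv d' c :=
  ceilDiv_le_of_le_mul hc (by
    have h1 := le_mul_ceilDiv d hc
    have h2 := le_mul_ceilDiv d' hc
    linarith [mul_add (c : ℤ) (ceilDiv d c) (ceilDiv d' c)])

/-- The threshold form of `⌈d/c⌉`: `⌈d/c⌉ ≥ t ↔ d ≥ c (t - 1) + 1` (`c > 0`). [folklore] -/
theorem le_ceilDiv_iff {d t : ℤ} {c : ℕ} (hc : 0 < c) : t ≤ ceilDiv d c ↔ (c : ℤ) * (t - 1) + 1 ≤ d := by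
  have hc' : (0 : ℤ) < c := by exact_mod_cast hc
  constructor
  · intro h
    by_contra hlt
    have hlt' : d ≤ (c : ℤ) * (t - 1) := by linarith [not_le.1 hlt]
    have : ceilDiv d c ≤ t - 1 := ceilDiv_le_of_le_mul hc hlt'
    linarith
  · intro h
    by_contra hlt
    have h1 := le_mul_ceilDiv d hc
    have h2 : ceilDiv d c ≤ t - 1 := by linarith [not_le.1 hlt]
    have := mul_le_mul_of_nonneg_left h2 hc'.le
    linarith

/-- `⌈d/1⌉ = d`. [folklore] -/
@[simp] theorem ceilDiv_one (d : ℤ) : ceilDiv d 1 = d := by simp [ceilDiv]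

/-- `⌈0/c⌉ = 0`. [folklore] -/
@[simp] theorem ceilDiv_zero (c : ℕ) : ceilDiv 0 c = 0 := by simp [ceilDiv]

/-- Soundness of ADDITION. [cite: CookCoullardTuran1987, §2] -/
theorem Holds.add {L M : CPLine ν} {σ : ν → Bool} (hL : L.Holds σ) (hM : M.Holds σ) :
    (L + M).Holds σ := by
  unfold Holds at *
  rw [const_add, lhs_add]
  exact add_le_add hL hM

/-- Soundness of MULTIPLICATION. [cite: CookCoullardTuran1987, §2] -/
theorem Holds.smul {L : CPLine ν} {σ : ν → Bool} (hL : L.Holds σ) (c : ℕ) : (smul c L).Holds σ := by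
  unfold Holds at *
  rw [const_smul, lhs_smul]
  exact mul_le_mul_of_nonneg_left hL (by positivity)

/-- Soundness of DIVISION: if `c > 0` divides all coefficients of a line holding under `σ`, the
divided line holds (the left-hand side is an integer, so the constant may be rounded up).
[cite: CookCoullardTuran1987, §2] -/
theorem Holds.divBy {L : CPLine ν} {σ : ν → Bool} (hL : L.Holds σ) {c : ℕ} (hc : 0 < c)
    (h : ∀ v, (c : ℤ) ∣ L.coeff v) : (divBy c L).Holds σ := by
  unfold Holds at *
  rw [const_divBy]
  exact ceilDiv_le_of_le_mul hc (by rw [mul_lhs_divBy h]; exact hL)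

/-- The bound `x ≥ 0` holds. [cite: CookCoullardTuran1987, §2] -/
theorem holds_lower (v : ν) (σ : ν → Bool) : (lower v).Holds σ := by
  simp [Holds, lower, lhs, bit_nonneg]

/-- The bound `-x ≥ -1` holds. [cite: CookCoullardTuran1987, §2] -/
theorem holds_upper (v : ν) (σ : ν → Bool) : (upper v).Holds σ := by
  simp [Holds, upper, lhs, bit_le_one]

/-- Evaluation of a literal's coefficient vector: the truth value of the literal, minus `1` for a
negative literal. [folklore] -/
theorem evalHom_litCoeff (σ : ν → Bool) (l : Literal ν) :
    evalHom σ (litCoeff l) = (if l.eval σ then 1 else 0) - (if l.2 = false then 1 else 0) := by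
  obtain ⟨v, b⟩ := l
  simp only [litCoeff, evalHom_single, Literal.eval, bit]
  cases b <;> rcases Bool.eq_false_or_eq_true (σ v) with h | h <;> simp [h]

/-- **The left-hand side of a clause inequality**: (number of true literals) `-` (number of
negative literals), literals counted once. [cite: CookCoullardTuran1987, §2] -/
theorem lhs_ofClause [DecidableEq ν] (C : Clause ν) (σ : ν → Bool) :
    (ofClause C).lhs σ = ((C.toFinset.filter fun l => l.eval σ = true).card : ℤ)
      - ((C.toFinset.filter fun l => l.2 = false).card : ℤ) := by
  unfold ofClause lhs
  simp only [map_sum, evalHom_litCoeff, Finset.sum_sub_distrib]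
  rw [Finset.natCast_card_filter, Finset.natCast_card_filter]

/-- **A clause inequality holds iff the clause is true.** [cite: CookCoullardTuran1987, §2] -/
theorem holds_ofClause_iff [DecidableEq ν] (C : Clause ν) (σ : ν → Bool) :
    (ofClause C).Holds σ ↔ C.eval σ = true := by
  unfold Holds
  rw [lhs_ofClause]
  simp only [ofClause, sub_le_sub_iff_right, Nat.one_le_cast, Finset.one_le_card]
  rw [Finset.filter_nonempty_iff]
  simp only [List.mem_toFinset]
  unfold Clause.eval
  rw [List.any_eq_true]

/-- A contradiction holds under no assignment. [folklore] -/
theorem IsContradiction.not_holds {L : CPLine ν} (h : L.IsContradiction) (σ : ν → Bool) : ¬ L.Holds σ := by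
  unfold Holds lhs
  rw [h.1, map_zero]
  exact not_le.2 h.2

/-! ### Norms -/

/-- The `ℓ¹`-norm of a line: `|b| + ∑_v |a_v|`. [cite: Pudlak1997, §3] -/
def norm (L : CPLine ν) : ℕ := L.const.natAbs + L.coeff.sum fun _ a => a.natAbs

/-- The constant is bounded by the norm. [folklore] -/
theorem natAbs_const_le_norm (L : CPLine ν) : L.const.natAbs ≤ L.norm := Nat.le_add_right _ _

/-- The absolute coefficient sum is bounded by the norm. [folklore] -/
theorem sum_natAbs_le_norm (L : CPLine ν) : (L.coeff.sum fun _ a => a.natAbs) ≤ L.norm :=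
  Nat.le_add_left _ _

/-- The absolute coefficient sum, as an integer. [folklore] -/
theorem sum_abs_eq (f : ν →₀ ℤ) : (f.sum fun _ a => |a|) = ((f.sum fun _ a => a.natAbs : ℕ) : ℤ) := by
  unfold Finsupp.sum
  push_cast
  rfl

/-- `|lhs| ≤ norm`. [folklore] -/
theorem abs_lhs_le_norm (L : CPLine ν) (σ : ν → Bool) : |L.lhs σ| ≤ L.norm := by
  unfold lhs norm
  refine (abs_evalHom_le σ L.coeff).trans ?_
  rw [sum_abs_eq]
  exact_mod_cast Nat.le_add_left _ _

end CPLine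

/-! ### Derivations and refutations -/

/-- The justification of a line of a cutting planes derivation: an axiom (clause inequality,
lower bound `x ≥ 0`, upper bound `-x ≥ -1`) or a rule (addition of lines `i, j`,
multiplication of line `i` by `c`, division of line `i` by `c`). [cite: CookCoullardTuran1987, §2] -/
inductive CPRule (ν : Type*)
  /-- the inequality of a clause of the refuted CNF -/
  | initial : CPRule ν
  /-- the bound `x_v ≥ 0` -/
  | lower (v : ν) : CPRule ν
  /-- the bound `-x_v ≥ -1` -/
  | upper (v : ν) : CPRule ν
  /-- the sum of lines `i` and `j` -/
  | add (i j : ℕ) : CPRule ν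
  /-- `c` times line `i` -/
  | mul (c : ℕ) (i : ℕ) : CPRule ν
  /-- line `i` divided by `c` (Gomory–Chvátal cut) -/
  | div (c : ℕ) (i : ℕ) : CPRule ν

/-- A line of a cutting planes derivation together with its justification.
[cite: CookCoullardTuran1987, §2] -/
structure CPStep (ν : Type*) where
  /-- the inequality derived at this line -/
  line : CPLine ν
  /-- the rule application justifying it -/
  rule : CPRule ν

variable {ν : Type*}

/-- Validity of a line given the earlier lines `prev` and the refuted CNF `φ`.
[cite: CookCoullardTuran1987, §2] -/
def IsValidCPStep [DecidableEq ν] (φ : CNF ν) (prev : List (CPStep ν)) (s : CPStep ν) : Prop :=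
  match s.rule with
  | .initial => ∃ C ∈ φ, s.line = CPLine.ofClause C
  | .lower v => s.line = CPLine.lower v
  | .upper v => s.line = CPLine.upper v
  | .add i j => ∃ hi : i < prev.length, ∃ hj : j < prev.length,
      s.line = (prev[i]'hi).line + (prev[j]'hj).line
  | .mul c i => ∃ hi : i < prev.length, s.line = CPLine.smul c (prev[i]'hi).line
  | .div c i => ∃ hi : i < prev.length, 0 < c ∧ (∀ v, (c : ℤ) ∣ (prev[i]'hi).line.coeff v) ∧
      s.line = CPLine.divBy c (prev[i]'hi).line

/-- `π` is a cutting planes derivation from `φ`: every line is valid with respect to the lines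
before it; `π.length` is its number of lines. [cite: CookCoullardTuran1987, §2] -/
def IsCPDerivation [DecidableEq ν] (φ : CNF ν) (π : List (CPStep ν)) : Prop :=
  ∀ k (hk : k < π.length), IsValidCPStep φ (π.take k) (π[k]'hk)

/-- `π` is a cutting planes REFUTATION of `φ`: a derivation containing a contradiction `0 ≥ b`,
`b > 0`. [cite: CookCoullardTuran1987, §2] -/
def IsCPRefutation [DecidableEq ν] (φ : CNF ν) (π : List (CPStep ν)) : Prop :=
  IsCPDerivation φ π ∧ ∃ s ∈ π, s.line.IsContradiction

/-- The NORM of a derivation: the maximal `ℓ¹`-norm of its lines (`0` for the empty one); a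
"proof with small coefficients" is one of polynomially bounded norm. [cite: Pudlak1997, §3] -/
def cpNorm (π : List (CPStep ν)) : ℕ :=
  (π.map fun s => s.line.norm).foldr max 0

/-- Every line's norm is bounded by the norm of the derivation. [folklore] -/
theorem norm_le_cpNorm {π : List (CPStep ν)} {s : CPStep ν} (h : s ∈ π) : s.line.norm ≤ cpNorm π := by
  unfold cpNorm
  induction π with
  | nil => simp at h
  | cons t π ih =>
    rw [List.map_cons, List.foldr_cons]
    rcases List.mem_cons.1 h with rfl | h
    · exact le_max_left _ _
    · exact (ih h).trans (le_max_right _ _)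

/-- **Soundness of cutting planes, line by line**: under an assignment satisfying `φ`, every line
of a derivation from `φ` holds. [cite: CookCoullardTuran1987, §2] -/
theorem holds_of_isCPDerivation [DecidableEq ν] {φ : CNF ν} {π : List (CPStep ν)}
    (hπ : IsCPDerivation φ π) {σ : ν → Bool} (hσ : φ.eval σ = true) (k : ℕ) (hk : k < π.length) :
    (π[k]'hk).line.Holds σ := by
  induction k using Nat.strong_induction_on with
  | _ k ih =>
    have hval := hπ k hk
    have htk : (π.take k).length = k := by simp; omega
    unfold IsValidCPStep at hval
    rcases hr : (π[k]'hk).rule with _ | v | v | ⟨i, j⟩ | ⟨c, i⟩ | ⟨c, i⟩ <;> rw [hr] at hval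
    · obtain ⟨C, hC, hL⟩ := hval
      rw [hL, CPLine.holds_ofClause_iff]
      exact (CNF.eval_eq_true_iff φ σ).1 hσ C hC
    · rw [hval]; exact CPLine.holds_lower v σ
    · rw [hval]; exact CPLine.holds_upper v σ
    · obtain ⟨hi, hj, hL⟩ := hval
      rw [htk] at hi hj
      rw [hL, List.getElem_take, List.getElem_take]
      exact (ih i hi (hi.trans hk)).add (ih j hj (hj.trans hk))
    · obtain ⟨hi, hL⟩ := hval
      rw [htk] at hi
      rw [hL, List.getElem_take]
      exact (ih i hi (hi.trans hk)).smul c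
    · obtain ⟨hi, hc, hdvd, hL⟩ := hval
      rw [htk] at hi
      rw [List.getElem_take] at hdvd hL
      rw [hL]
      exact (ih i hi (hi.trans hk)).divBy hc hdvd

/-- **Soundness of cutting planes**: a refuted CNF is unsatisfiable.
[cite: CookCoullardTuran1987, §2] -/
theorem not_satisfiable_of_isCPRefutation [DecidableEq ν] {φ : CNF ν} {π : List (CPStep ν)}
    (hπ : IsCPRefutation φ π) : ¬ φ.Satisfiable := by
  rintro ⟨σ, hσ⟩
  obtain ⟨hder, s, hs, hcontra⟩ := hπ
  obtain ⟨k, hk, rfl⟩ := List.mem_iff_getElem.1 hs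
  exact hcontra.not_holds σ (holds_of_isCPDerivation hder hσ k hk)

end Literature.Computability.MetaComplexity
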